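import Summits.ABC.IUTFork.Cor312LicenceWildInhabitedRealising
import Literature.IUT.LogVolume.TensorPacketFactorDifferentMin
import HarnessLib

/-!
# [IUTchIII] Cor. 3.12 — the (xi-f) licence / branch C's antecedent INHABITED at fibres of SEVERAL local types:
# the mixed-fibre socket (bad completions over one prime NOT pairwise isomorphic)

PROOF-ONLY file (D-0012; 0 definitions, 0 `Prop` facts) of the abc-iut cell — D-0079 RESCUE sub-cell R-W «WINDOW Θ-SIDE INEQUALITY»,
lane U, row «W:U2-MIXED-FIBRE-SOCKET» (abc-iut-plan g10 2026-08-26T23:54:10Z), seat abc-iut-w5-d180 gen 8; sequel of abc-iut-W-row-1's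
single-type socket `Cor312LicenceWildInhabitedRealising` (p470548). TAKES NO SIDE on [IUTchIII] Cor. 3.12 (S. Mochizuki, *Inter-universal
Teichmüller theory III*, kurims manuscript, Cor. 3.12 p. 173 l. 41 – p. 174 l. 19; Step (xi-f) p. 184 l. 26–29; Thm. 3.11 (i) (Ind1)(Ind2)
p. 154) or on any author: statements about OUR typed objects (abc-iut-c312-7's `settingPrVolSharp`, abc-iut-c312-5's `presAt` and typed
(Ind1)(Ind2), branch C's `QPinned ∧ PilotKummerCompatHull`); the hull-level licence is a STRONGER-THAN-PRINT reading of Step (xi-f); nothing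
here bears on the printed GLOBAL inequality or the number-level corollary; the existence of initial Θ-data realising the hypotheses is NOT
claimed. typed ≠ proved; instantiated ≠ endorsed.

WHY. abc-iut-W-row-1's socket `licence_settingPrVolSharp_of_orders_of_realises` asks that the bad completions `K_x`, `x | p`, be PAIRWISE
`ℚ_p`-ISOMORPHIC (`hiso`; different gain `(|I|−1)·d` by `dSum_sub_inf_differentOrd_dFac_eq_of_algEquiv'`). At a datum whose field of moduli has
SEVERAL places over `p` with different `(e, P_q)` — the R-W WINDOW-TABLE rows «broberg-Q7:7 / :11» (F_mod = ℚ(√7); over `3` the places of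
`h = 24` and `h = 2`) — the bad completions over `p` fall into several isomorphism TYPES and `hiso` fails. THIS FILE removes that restriction:

* §1 **`sub_le_dSum_sub_inf_differentOrd_dFac_of_types`** (Literature-level, any packet): if slot `i` is `ℚ_p`-isomorphic to the model
  `k'_{c(i)}` of its TYPE `c(i) ∈ S` and `d₀(s) ≤ d(k'_s)` for the types that occur, then
  **`Σ_i d₀(c i) − Σ_{s ∈ im c} d₀(s) ≤ d_I − min_J d_{L_J}`** — i.e. `Σ_{types s present} (n_s − 1)·d₀(s)`: abc-iut-w6-d018's
  `inf_differentOrd_dFac_le_of_types` (the least factor different is at most that of the packet of the DISTINCT types) and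
  `inf_differentOrd_dFac_le_dSum` (which is at most their sum). One type: `(|I|−1)·d₀` (abc-iut-W-row-1's case); the loss at a mixed tuple is
  one `d` per EXTRA type, not per slot. Only LOWER bounds on the differents enter.
* §2 **`licence_settingPrVolSharp_of_mixedOrders_of_realises`** — THE MIXED-FIBRE SOCKET. Θ- and q-ideles REALISING the pilot divisors of `X`
  (Dupuy–Hilado (3.4)). Per prime `p`: a TYPE map `c : Fibre(p) → Fin t_p`; per type `u` integers `e_u, D_u, P_u ∈ ℕ`, `ρin_u, ρout_u ∈ ℤ`
  with abc-iut-W-row-1's `hloc` conjuncts at EVERY bad `x` of type `u` (`e(K_x/ℚ_p) = e_u`, `D_u/e_u ≤ d(K_x)`, `P_q(x) = P_u`, a NON-logarithm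
  `z` with `‖z‖ ≤ p^{−(ρin_u−1)/e_u}`, a logarithm `z'` with `p^{−ρout_u/e_u} ≤ ‖z'‖`); bad places of the SAME type have `ℚ_p`-isomorphic
  completions (`hiso`, Galois theory of `K/F_mod` per place of `F_mod`); and for every label `j = i+1` and every TYPE PROFILE
  `f : Caps(j) → Fin t_p` all of whose types occur at bad places, SOME slot `s` (the composer's choice: the SHALLOWEST type present makes the
  content smallest) satisfies, for all `m ∈ ℤ`,
  `m ≤ j²·P_{f s}/e_{f s} − (Σ_a D_{f a}/e_{f a} − Σ_{u ∈ im f} D_u/e_u) − Σ_a ρin_{f a}/e_{f a}  ⟹  m ≤ P_{f(last)}/e_{f(last)} − Σ_a ρout_{f a}/e_{f a}`.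
  THEN abc-iut-c312-1's `Thm311ToCor312.Licence` holds at `settingPrVolSharp X …`: abc-iut-w4-d036's exact cell (p460046/p460573) at the
  EXACT binders of EVERY place (abc-iut-W-row-1's `exists_shellRadii_binders`), (Ind1) `σ = swap(s, last)`, good slots by abc-iut-W-row-1's
  swap, radii weakened by `norm_inner_le_of_not_mem` / dominance, different gain by §1.
* §3 **`exists_qPinned_and_hull_settingPrVolSharp_of_mixedOrders_of_realises`** — branch C's «∃ ρ qK, QPinned ∧ PilotKummerCompatHull», same hypotheses.

READING (neutral): for broberg-Q7:7/:11 the composer supplies per bad prime the types, five integers per type, the in-type isomorphisms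
and `≤ 2^{j+1}` profile inequalities per label; the local types (`e_u`, wild `δ`) stay inputs BY NAME. HONEST SCOPE: OUR sharp containers and
Dupuy–Hilado's typed (Ind1)/(Ind2); STRONGER-THAN-PRINT hull reading; nothing about the printed GLOBAL inequality or the existence of initial
Θ-data; no side taken on [IUTchIII] Cor. 3.12. [cite: Mochizuki2012, IUTchIII Cor. 3.12 p. 173–175, Step (xi) (xi-d)(xi-f) p. 183–184, Thm. 3.11 (i)
p. 154; IUTchIV Prop. 1.1 p. 9, Prop. 1.2 (i)(ii) p. 10, Prop. 1.4 (i) p. 13] [cite: DupuyHilado2025, §3.3, §3.4, §3.9, §4.9, §4.12]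
[cite: NeukirchANT1999, Ch. II (5.5)] [claim: Mochizuki2012, status: disputed] for every IUT sentence quoted.
-/

noncomputable section

open Set Function Metric
open scoped Pointwise TensorProduct

/-! ## §1. The different gain at a packet whose slots have SEVERAL types -/

namespace Literature.IUT.LogVolume

open Literature.NumberTheory.GaloisRepresentations.Ultrametric

section Types

variable (p : ℕ) [Fact p.Prime]
variable {I : Type} [Fintype I] [DecidableEq I] [Nonempty I]
variable (k : I → Type) [∀ i, NontriviallyNormedField (k i)] [∀ i, NormedAlgebra ℚ_[p] (k i)]
  [∀ i, IsUltrametricDist (k i)] [∀ i, ProperSpace (k i)]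
variable {S : Type} [DecidableEq S]
variable (k' : S → Type) [∀ s, NontriviallyNormedField (k' s)] [∀ s, NormedAlgebra ℚ_[p] (k' s)]
  [∀ s, IsUltrametricDist (k' s)] [∀ s, ProperSpace (k' s)]

/-- **THE DIFFERENT GAIN AT A PACKET OF SEVERAL TYPES, FROM BELOW.** Slots `k_i ≃ₐ[ℚ_p] k'_{c(i)}` for a type map `c : I → S` and models
`k'_s`; lower bounds `d₀(s) ≤ d(k'_s)` at the types that occur. Then `Σ_i d₀(c i) − Σ_{s ∈ im c} d₀(s) ≤ d_I − min_J d_{L_J}` — the least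
factor different is at most `Σ_{s ∈ im c} d(k'_s)` (abc-iut-w6-d018: `inf_differentOrd_dFac_le_of_types` onto the packet of the occurring types,
then `inf_differentOrd_dFac_le_dSum`), while `d_I = Σ_{s ∈ im c} n_s·d(k'_s)`, `n_s ≥ 1`. [cite: Mochizuki2012, IUTchIV Prop. 1.1 p. 9, Prop. 1.4 (i) p. 13] -/
theorem sub_le_dSum_sub_inf_differentOrd_dFac_of_types (c : I → S) (τ : ∀ i, k' (c i) ≃ₐ[ℚ_[p]] k i) (d₀ : S → ℝ)
    (hd₀ : ∀ s ∈ (Finset.univ : Finset I).image c, d₀ s ≤ differentOrd p (k' s)) :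
    (∑ i, d₀ (c i)) - ∑ s ∈ (Finset.univ : Finset I).image c, d₀ s ≤
      dSum p k - (Finset.univ : Finset (DIdx p k)).inf' Finset.univ_nonempty (fun J => differentOrd p (DFac p k J)) := by
  classical
  obtain ⟨i₀⟩ := (inferInstance : Nonempty I)
  set T : Finset S := (Finset.univ : Finset I).image c with hT
  haveI : Nonempty (T : Type) := ⟨⟨c i₀, Finset.mem_image_of_mem c (Finset.mem_univ i₀)⟩⟩
  -- (1) the least factor different is at most the sum of the differents of the occurring types
  have hsurj : Function.Surjective (fun i : I => (⟨c i, Finset.mem_image_of_mem c (Finset.mem_univ i)⟩ : (T : Type))) := by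
    rintro ⟨s, hs⟩
    obtain ⟨i, -, rfl⟩ := Finset.mem_image.mp hs
    exact ⟨i, rfl⟩
  have h1 := inf_differentOrd_dFac_le_of_types p k (fun u : (T : Type) => k' (u : S))
    (fun i : I => (⟨c i, Finset.mem_image_of_mem c (Finset.mem_univ i)⟩ : (T : Type))) hsurj (fun i => τ i)
  have h2 := inf_differentOrd_dFac_le_dSum p (fun u : (T : Type) => k' (u : S))
  have h3 : dSum p (fun u : (T : Type) => k' (u : S)) = ∑ s ∈ T, differentOrd p (k' s) := by
    unfold dSum
    exact Finset.sum_coe_sort T (fun s => differentOrd p (k' s))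
  have hinf : (Finset.univ : Finset (DIdx p k)).inf' Finset.univ_nonempty (fun J => differentOrd p (DFac p k J)) ≤
      ∑ s ∈ T, differentOrd p (k' s) := by
    rw [← h3]; exact h1.trans h2
  -- (2) the slot differents are those of their types
  have hslot : ∀ i, differentOrd p (k i) = differentOrd p (k' (c i)) := fun i =>
    (differentOrd_eq_of_isometry_of_surjective p (τ i : k' (c i) →ₐ[ℚ_[p]] k i) (fun x => norm_map_algHom _ x)
      (τ i).surjective).symm
  have hdSum : dSum p k = ∑ s ∈ T, ((Finset.univ.filter fun i => c i = s).card : ℝ) * differentOrd p (k' s) := by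
    unfold dSum
    simp_rw [hslot]
    have h := Finset.sum_comp (s := (Finset.univ : Finset I)) (fun s => differentOrd p (k' s)) c
    simp only [nsmul_eq_mul] at h
    exact h
  have hd₀sum : ∑ i, d₀ (c i) = ∑ s ∈ T, ((Finset.univ.filter fun i => c i = s).card : ℝ) * d₀ s := by
    have h := Finset.sum_comp (s := (Finset.univ : Finset I)) d₀ c
    simp only [nsmul_eq_mul] at h
    exact h
  -- (3) termwise comparison: `n_s ≥ 1` and `d₀ s ≤ d(k'_s)` on `T`
  have hterm : ∀ s ∈ T, (((Finset.univ.filter fun i => c i = s).card : ℝ) - 1) * d₀ s ≤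
      (((Finset.univ.filter fun i => c i = s).card : ℝ) - 1) * differentOrd p (k' s) := by
    intro s hs
    refine mul_le_mul_of_nonneg_left (hd₀ s hs) ?_
    obtain ⟨i, -, rfl⟩ := Finset.mem_image.mp hs
    have h1' : 1 ≤ (Finset.univ.filter fun i' => c i' = c i).card :=
      Finset.card_pos.mpr ⟨i, Finset.mem_filter.mpr ⟨Finset.mem_univ i, rfl⟩⟩
    have : (1 : ℝ) ≤ ((Finset.univ.filter fun i' => c i' = c i).card : ℝ) := by exact_mod_cast h1'
    linarith
  calc (∑ i, d₀ (c i)) - ∑ s ∈ T, d₀ s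
      = ∑ s ∈ T, (((Finset.univ.filter fun i => c i = s).card : ℝ) - 1) * d₀ s := by
        rw [hd₀sum, ← Finset.sum_sub_distrib]
        exact Finset.sum_congr rfl fun s _ => by ring
    _ ≤ ∑ s ∈ T, (((Finset.univ.filter fun i => c i = s).card : ℝ) - 1) * differentOrd p (k' s) :=
        Finset.sum_le_sum hterm
    _ = dSum p k - ∑ s ∈ T, differentOrd p (k' s) := by
        rw [hdSum, ← Finset.sum_sub_distrib]
        exact Finset.sum_congr rfl fun s _ => by ring
    _ ≤ _ := by linarith

end Types

end Literature.IUT.LogVolume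

/-! ## §2. The licence at `settingPrVolSharp` for realising ideles, fibres of several types -/

namespace Summit.ABC.IUTFork.Thm311.Real

open Cor312 Cor312.Setting Cor312Vol Cor312Vol.ExplicitDepth Literature.IUT.LogThetaLattice Literature.IUT.LogVolume NumberField
  IsDedekindDomain
open Literature.NumberTheory.NumberFields Literature.NumberTheory.GaloisRepresentations.Ultrametric

variable {F : Type} [Field F] [NumberField F] (X : PilotData F) {logv : PadicLogs F} (hlog : LogvAnalytic logv)
  (M : Type) [Field M] [NumberField M]
  (archPk : ∀ (j : (thetaIndex X).Label) (vQ : (thetaIndex X).VQ), Set ((logShellsDH X logv).Packet j vQ))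
  (archSub : ∀ (j : (thetaIndex X).Label) (v : (thetaIndex X).V),
    Set ((logShellsDH X logv).Packet j ((thetaIndex X).over v)))
  (Ψ : ℤ → ∀ v : (thetaIndex X).V, v ∈ (thetaIndex X).Vbad → Set ((logShellsDH X logv).StarPacket v))
  (act : ℤ → ∀ v : (thetaIndex X).V, v ∈ (thetaIndex X).Vbad →
    (logShellsDH X logv).StarPacket v → Module.End ℚ ((logShellsDH X logv).StarPacket v))
  (Mmod : ℤ → ∀ j : (thetaIndex X).LabelStar, Set ((logShellsDH X logv).GlobalPacket j.1))
  (region : ℤ → ∀ j : (thetaIndex X).LabelStar, FinDivisor M → ∀ vQ : (thetaIndex X).VQ,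
    Set ((logShellsDH X logv).Packet j.1 vQ))
  (n : ℤ) {HT : Type} {LogLink : HT → HT → Type} {IsFull : ∀ {s t : HT}, LogLink s t → Prop}
  (lat : LGPGaussianLogThetaLattice LogLink IsFull)
  {Frd : Type} {IsoF : Frd → Frd → Type} {Ob : Frd → Type} {realify : Frd → Frd} {Strip : Type}
  {IsoS : Strip → Strip → Type} {Mv : ∀ v : (thetaIndex X).V, v ∈ (thetaIndex X).Vbad → Type}
  [∀ v h, Monoid (Mv v h)]
  (sig : GlobalLGPFrobenioidSignature (thetaIndex X).lstar (thetaIndex X).V (· ∈ (thetaIndex X).Vbad)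
    Frd IsoF Ob realify Strip IsoS Mv)
  (split : SplittingMonoids Mv) {ObΔ : Type} {N : ∀ v : (thetaIndex X).V, v ∈ (thetaIndex X).Vbad → Type}
  [∀ v h, Monoid (N v h)] (qData : QPilotData ObΔ N)
  (tq : ∀ (pp : Nat.Primes) (x : (thetaIndex X).Fibre (.inr pp)), haveI : Fact (pp : ℕ).Prime := ⟨pp.2⟩; kOf X pp.1 x)
  (t : ∀ (pp : Nat.Primes) (_ : Fin X.lstar) (x : (thetaIndex X).Fibre (.inr pp)),
    haveI : Fact (pp : ℕ).Prime := ⟨pp.2⟩; kOf X pp.1 x)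
  (htq0 : ∀ pp x, tq pp x ≠ 0)
  (htq1 : ∀ (pp : Nat.Primes) (x : (thetaIndex X).Fibre (.inr pp)),
    haveI : Fact (pp : ℕ).Prime := ⟨pp.2⟩; placeOf X pp.1 x ∉ X.S → ‖tq pp x‖ = 1)
  (col : ℤ → Column (logShellsDH X logv))
  (ht0 : ∀ pp i x, t pp i x ≠ 0)
  (ht : ∀ (pp : Nat.Primes) (i : Fin X.lstar) (x : (thetaIndex X).Fibre (.inr pp)),
    haveI : Fact (pp : ℕ).Prime := ⟨pp.2⟩
    Real.log ‖t pp i x‖ = -(X.thetaPilot i (placeOf X pp.1 x)) * logNorm F (placeOf X pp.1 x) /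
      localDegree F (placeOf X pp.1 x))
  (htq : ∀ (pp : Nat.Primes) (x : (thetaIndex X).Fibre (.inr pp)),
    haveI : Fact (pp : ℕ).Prime := ⟨pp.2⟩
    Real.log ‖tq pp x‖ = -(X.qPilot (placeOf X pp.1 x)) * logNorm F (placeOf X pp.1 x) /
      localDegree F (placeOf X pp.1 x))

include ht0 ht htq in
/-- **THE (xi-f) LICENCE AT `settingPrVolSharp` FOR REALISING IDELES, FIBRES OF SEVERAL LOCAL TYPES.** Θ- and q-ideles realising the
pilot divisors of `X` (Dupuy–Hilado (3.4)). Per prime `p`: a type map `c : Fibre(p) → Fin t_p` and per type `u` integers `e_u, D_u, P_u ∈ ℕ`,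
`ρin_u, ρout_u ∈ ℤ` such that (i) every BAD `x | p` of type `u` has `e(K_x/ℚ_p) = e_u`, `D_u/e_u ≤ d(K_x)`, `P_q(x) = P_u`, some
`z ∉ log_p(𝒪^×_{K_x})` with `‖z‖ ≤ p^{−(ρin_u−1)/e_u}` and some `z' ∈ log_p(𝒪^×_{K_x})` with `p^{−ρout_u/e_u} ≤ ‖z'‖`; (ii) bad places of the
SAME type have `ℚ_p`-isomorphic completions; (iii) for every label `j = i+1 ≤ l⋆` and every type profile `f : Caps(j) → Fin t_p` realised
by bad places, SOME slot `s` satisfies `∀ m ∈ ℤ, m ≤ j²·P_{f s}/e_{f s} − (Σ_a D_{f a}/e_{f a} − Σ_{u ∈ im f} D_u/e_u) − Σ_a ρin_{f a}/e_{f a}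
→ m ≤ P_{f last}/e_{f last} − Σ_a ρout_{f a}/e_{f a}`. THEN abc-iut-c312-1's `Thm311ToCor312.Licence` holds at abc-iut-c312-7's
`settingPrVolSharp X …` — abc-iut-w4-d036's exact cell at every prime, label and tuple with (Ind1) `σ = swap(s, last)`, the radii weakened to
the one-sided data and the different gain to §1's bound. [cite: Mochizuki2012, IUTchIII Cor. 3.12 Step (xi-f) p. 184; Thm. 3.11 (i)
(Ind1)(Ind2) p. 154; IUTchIV Prop. 1.1 p. 9, Prop. 1.2 (i)(ii) p. 10, Prop. 1.4 (i) p. 13] [cite: DupuyHilado2025, §3.3, §3.4, §3.9, §4.9, §4.12]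
[claim: Mochizuki2012, status: disputed] -/
theorem licence_settingPrVolSharp_of_mixedOrders_of_realises (ty : Nat.Primes → ℕ)
    (c : ∀ pp : Nat.Primes, (thetaIndex X).Fibre (.inr pp) → Fin (ty pp))
    (e D P : ∀ pp : Nat.Primes, Fin (ty pp) → ℕ) (ρin ρout : ∀ pp : Nat.Primes, Fin (ty pp) → ℤ)
    (hloc : ∀ (pp : Nat.Primes) (x : (thetaIndex X).Fibre (.inr pp)),
      haveI : Fact (pp : ℕ).Prime := ⟨pp.2⟩
      placeOf X pp.1 x ∈ X.S →
        absRamificationIdx (pp : ℕ) (kOf X pp.1 x) = e pp (c pp x) ∧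
        (D pp (c pp x) : ℝ) / (e pp (c pp x) : ℝ) ≤ differentOrd (pp : ℕ) (kOf X pp.1 x) ∧
        X.qPilot (placeOf X pp.1 x) = P pp (c pp x) ∧
        (∃ z : kOf X pp.1 x, z ∉ logUnits (kOf X pp.1 x) ∧
          ‖z‖ ≤ ((pp : ℕ) : ℝ) ^ (-(((ρin pp (c pp x) : ℝ) - 1) / (e pp (c pp x) : ℝ)))) ∧
        (∃ z ∈ logUnits (kOf X pp.1 x), ((pp : ℕ) : ℝ) ^ (-((ρout pp (c pp x) : ℝ) / (e pp (c pp x) : ℝ))) ≤ ‖z‖))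
    (hiso : ∀ (pp : Nat.Primes) (x y : (thetaIndex X).Fibre (.inr pp)),
      haveI : Fact (pp : ℕ).Prime := ⟨pp.2⟩
      placeOf X pp.1 x ∈ X.S → placeOf X pp.1 y ∈ X.S → c pp x = c pp y → Nonempty (kOf X pp.1 x ≃ₐ[ℚ_[pp]] kOf X pp.1 y))
    (hcell : ∀ (pp : Nat.Primes) (i : Fin X.lstar) (f : (thetaIndex X).Caps (Setting.labelSucc i) → Fin (ty pp)),
      (haveI : Fact (pp : ℕ).Prime := ⟨pp.2⟩
        ∀ a, ∃ x : (thetaIndex X).Fibre (.inr pp), placeOf X pp.1 x ∈ X.S ∧ c pp x = f a) →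
      ∃ s : (thetaIndex X).Caps (Setting.labelSucc i), ∀ m : ℤ,
        ((m : ℝ) ≤ ((((i : ℕ) + 1 : ℕ) : ℝ) ^ 2 * (P pp (f s) : ℝ)) / (e pp (f s) : ℝ)
            - ((∑ a, (D pp (f a) : ℝ) / (e pp (f a) : ℝ)) - ∑ u ∈ (Finset.univ.image f), (D pp u : ℝ) / (e pp u : ℝ))
            - ∑ a, (ρin pp (f a) : ℝ) / (e pp (f a) : ℝ)) →
        ((m : ℝ) ≤ (P pp (f (Fin.last _)) : ℝ) / (e pp (f (Fin.last _)) : ℝ) - ∑ a, (ρout pp (f a) : ℝ) / (e pp (f a) : ℝ))) :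
    Thm311ToCor312.Licence (settingPrVolSharp X hlog M archPk archSub Ψ act Mmod region n lat sig split qData tq t htq0 htq1) := by
  classical
  have hB : ∀ (pp : Nat.Primes) (x : (thetaIndex X).Fibre (.inr pp)), haveI : Fact (pp : ℕ).Prime := ⟨pp.2⟩
      ∃ cin cout : (presAt X hlog pp).k x, cin ≠ 0 ∧ (∀ o : (presAt X hlog pp).k x, ‖o‖ ≤ 1 → cin * o ∈ logUnits ((presAt X hlog pp).k x)) ∧
        (∃ (ϖ : ((presAt X hlog pp).k x)ˣ) (w : (presAt X hlog pp).k x),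
          IsUniformizer ϖ ∧ w ∉ logUnits ((presAt X hlog pp).k x) ∧ ‖w‖ * ‖(ϖ : (presAt X hlog pp).k x)‖ ≤ ‖cin‖) ∧
        cout ≠ 0 ∧ cout ∈ logUnits ((presAt X hlog pp).k x) ∧ ∀ z ∈ logUnits ((presAt X hlog pp).k x), ‖z‖ ≤ ‖cout‖ := by
    intro pp x
    haveI : Fact (pp : ℕ).Prime := ⟨pp.2⟩
    exact exists_shellRadii_binders (pp : ℕ) ((presAt X hlog pp).k x)
  choose cin cout hin0 hin hmax hout0 houtΛ hdom using hB
  refine (licence_settingPrVolSharp_iff_shellRadii_of_realises X hlog M archPk archSub Ψ act Mmod region n lat sig split qData tq t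
    htq0 htq1 ht0 ht htq cin cout hin0 hin hmax hout0 houtΛ hdom).2 fun pp i ev => ?_
  haveI : Fact (pp : ℕ).Prime := ⟨pp.2⟩
  have hp1 : (1 : ℝ) < ((pp : ℕ) : ℝ) := by exact_mod_cast pp.2.one_lt
  have hp0 : (0 : ℝ) < ((pp : ℕ) : ℝ) := by linarith
  -- `‖cin a‖ ≤ ‖cout a‖` at every slot, products nonnegative
  have hinout : ∀ x : (thetaIndex X).Fibre (.inr pp), ‖cin pp x‖ ≤ ‖cout pp x‖ := fun x =>
    hdom pp x _ (by simpa using hin pp x 1 (by simp))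
  have hprod_le : ∏ a, ‖cin pp (ev a)‖ ≤ ∏ a, ‖cout pp (ev a)‖ :=
    Finset.prod_le_prod (fun a _ => norm_nonneg _) fun a _ => hinout (ev a)
  have hprod_nn : 0 ≤ ∏ a, ‖cin pp (ev a)‖ := Finset.prod_nonneg fun a _ => norm_nonneg _
  by_cases hall : ∀ a, placeOf X pp.1 (ev a) ∈ X.S
  swap
  · -- a GOOD slot `a₀` (abc-iut-W-row-1's swap): the Θ-radius there is `1`, the hypothesis forces `p^m ≤ ∏‖cin‖ ≤ ∏‖cout‖`
    push Not at hall
    obtain ⟨a₀, ha₀⟩ := hall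
    refine ⟨Equiv.swap a₀ (Fin.last _), fun m hm => ?_⟩
    have hσ : (Equiv.swap a₀ (Fin.last _)) (Fin.last _) = a₀ := Equiv.swap_apply_right _ _
    obtain ⟨J₀⟩ := (inferInstance : Nonempty (DIdx (pp : ℕ) ((presAt X hlog pp).kk ev)))
    have hJ := hm J₀
    rw [hσ, ← norm_thetaIdele_eq_rpow_of_realises X tq t htq0 ht0 ht htq pp i (ev a₀),
      norm_eq_one_of_realises X t ht0 ht pp i (ev a₀) ha₀, mul_one] at hJ
    have hexp : ((pp : ℕ) : ℝ) ^ (-(dSum (pp : ℕ) ((presAt X hlog pp).kk ev) -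
        differentOrd (pp : ℕ) (DFac (pp : ℕ) ((presAt X hlog pp).kk ev) J₀))) ≤ 1 :=
      Real.rpow_le_one_of_one_le_of_nonpos hp1.le (by
        have := differentOrd_dFac_le_dSum (pp : ℕ) ((presAt X hlog pp).kk ev) J₀
        linarith)
    have hm' : ((pp : ℕ) : ℝ) ^ m ≤ ∏ a, ‖cout pp (ev a)‖ :=
      hJ.trans ((mul_le_of_le_one_left hprod_nn hexp).trans hprod_le)
    rw [← norm_qIdele_eq_rpow_of_realises X tq htq0 htq pp (ev (Fin.last _))]
    exact (mul_le_of_le_one_right (zpow_nonneg hp0.le _)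
      (norm_qIdele_le_one_of_realises X tq htq0 htq pp (ev (Fin.last _)))).trans hm'
  · -- ALL slots bad: the type profile `f a := c (ev a)` of the tuple
    obtain ⟨s, hs⟩ := hcell pp i (fun a => c pp (ev a)) (fun a => ⟨ev a, hall a, rfl⟩)
    refine ⟨Equiv.swap s (Fin.last _), fun m hm => ?_⟩
    have hσ : (Equiv.swap s (Fin.last _)) (Fin.last _) = s := Equiv.swap_apply_right _ _
    rw [hσ] at hm
    have hcard : Fintype.card ((thetaIndex X).Caps (Setting.labelSucc i)) = (i : ℕ) + 2 := by
      have hc : Fintype.card ((thetaIndex X).Caps (Setting.labelSucc i)) =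
          Fintype.card (Fin (((Setting.labelSucc i : (thetaIndex X).Label) : ℕ) + 1)) := rfl
      rw [hc, Fintype.card_fin]
      simp [Setting.labelSucc]
    -- per-slot data from `hloc`
    have he : ∀ a, absRamificationIdx (pp : ℕ) (kOf X pp.1 (ev a)) = e pp (c pp (ev a)) := fun a => (hloc pp (ev a) (hall a)).1
    have hepos : ∀ a, 0 < e pp (c pp (ev a)) := fun a => by
      rw [← he a]; exact absRamificationIdx_pos (pp : ℕ) (kOf X pp.1 (ev a))
    have hram : ∀ a, (ramIdx F (placeOf X pp.1 (ev a)) : ℝ) = e pp (c pp (ev a)) := fun a => by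
      rw [ramIdx_eq F (placeOf X pp.1 (ev a)), ← absRamificationIdx_rescaledCompletion F (pp : ℕ) (placeOf X pp.1 (ev a))
        (natCast_mem_placeOf X pp.1 (ev a))]
      exact_mod_cast he a
    have hP : ∀ a, X.qPilot (placeOf X pp.1 (ev a)) = P pp (c pp (ev a)) := fun a => (hloc pp (ev a) (hall a)).2.2.1
    have hin_le : ∀ a, ‖cin pp (ev a)‖ ≤ ((pp : ℕ) : ℝ) ^ (-((ρin pp (c pp (ev a)) : ℝ) / (e pp (c pp (ev a)) : ℝ))) := by
      intro a
      obtain ⟨-, -, -, ⟨z, hz, hzle⟩, -⟩ := hloc pp (ev a) (hall a)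
      have h := norm_inner_le_of_not_mem (pp : ℕ) (kOf X pp.1 (ev a)) (hin pp (ev a)) hz (ρ := ρin pp (c pp (ev a)))
        (by rw [he a]; exact hzle)
      rw [he a] at h
      exact h
    have hout_ge : ∀ a, ((pp : ℕ) : ℝ) ^ (-((ρout pp (c pp (ev a)) : ℝ) / (e pp (c pp (ev a)) : ℝ))) ≤ ‖cout pp (ev a)‖ := by
      intro a
      obtain ⟨-, -, -, -, ⟨z, hz, hzge⟩⟩ := hloc pp (ev a) (hall a)
      exact hzge.trans (hdom pp (ev a) z hz)
    -- products of the one-sided radii as single powers of `p`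
    have hprod_in : ∏ a, ‖cin pp (ev a)‖ ≤
        ((pp : ℕ) : ℝ) ^ (∑ a, -((ρin pp (c pp (ev a)) : ℝ) / (e pp (c pp (ev a)) : ℝ))) := by
      rw [Real.rpow_sum_of_pos hp0]
      exact Finset.prod_le_prod (fun a _ => norm_nonneg _) fun a _ => hin_le a
    have hprod_out : ((pp : ℕ) : ℝ) ^ (∑ a, -((ρout pp (c pp (ev a)) : ℝ) / (e pp (c pp (ev a)) : ℝ))) ≤
        ∏ a, ‖cout pp (ev a)‖ := by
      rw [Real.rpow_sum_of_pos hp0]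
      exact Finset.prod_le_prod (fun a _ => by positivity) fun a _ => hout_ge a
    -- §1: the different gain from below, with models the completions at chosen bad representatives of the occurring types
    have hrep : ∀ u : Fin (ty pp), ∃ y : (thetaIndex X).Fibre (.inr pp),
        (∃ x : (thetaIndex X).Fibre (.inr pp), placeOf X pp.1 x ∈ X.S ∧ c pp x = u) → placeOf X pp.1 y ∈ X.S ∧ c pp y = u := by
      intro u
      by_cases h : ∃ x : (thetaIndex X).Fibre (.inr pp), placeOf X pp.1 x ∈ X.S ∧ c pp x = u
      · obtain ⟨x, hx⟩ := h; exact ⟨x, fun _ => hx⟩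
      · exact ⟨ev (Fin.last _), fun h' => absurd h' h⟩
    choose rep hrep using hrep
    have hrep' : ∀ a, placeOf X pp.1 (rep (c pp (ev a))) ∈ X.S ∧ c pp (rep (c pp (ev a))) = c pp (ev a) := fun a =>
      hrep _ ⟨ev a, hall a, rfl⟩
    have τ : ∀ a, kOf X pp.1 (rep (c pp (ev a))) ≃ₐ[ℚ_[pp]] (presAt X hlog pp).kk ev a := fun a =>
      Classical.choice (hiso pp (rep (c pp (ev a))) (ev a) (hrep' a).1 (hall a) (hrep' a).2)
    have hgain := sub_le_dSum_sub_inf_differentOrd_dFac_of_types (pp : ℕ) ((presAt X hlog pp).kk ev)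
      (fun u : Fin (ty pp) => kOf X pp.1 (rep u)) (fun a => c pp (ev a)) τ
      (fun u => (D pp u : ℝ) / (e pp u : ℝ)) (by
        intro u hu
        obtain ⟨a, -, rfl⟩ := Finset.mem_image.mp hu
        obtain ⟨-, hD, -, -, -⟩ := hloc pp (rep (c pp (ev a))) (hrep' a).1
        rw [(hrep' a).2] at hD
        exact hD)
    -- collapse the `∀ J` hypothesis to the least factor different, then to one power of `p`
    have hm1 := (forall_dFac_le_rpow_mul_iff_inf (pp : ℕ) ((presAt X hlog pp).kk ev) hprod_nn).1 hm
    rw [hP s, hram s] at hm1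
    set G : ℝ := (∑ a, (D pp (c pp (ev a)) : ℝ) / (e pp (c pp (ev a)) : ℝ)) -
      ∑ u ∈ (Finset.univ.image fun a => c pp (ev a)), (D pp u : ℝ) / (e pp u : ℝ) with hG
    have hΔle : ((pp : ℕ) : ℝ) ^ (-(dSum (pp : ℕ) ((presAt X hlog pp).kk ev) -
        (Finset.univ : Finset (DIdx (pp : ℕ) ((presAt X hlog pp).kk ev))).inf' Finset.univ_nonempty
          (fun J => differentOrd (pp : ℕ) (DFac (pp : ℕ) ((presAt X hlog pp).kk ev) J)))) ≤ ((pp : ℕ) : ℝ) ^ (-G) :=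
      Real.rpow_le_rpow_of_exponent_le hp1.le (by linarith [hgain])
    have hm2 : ((pp : ℕ) : ℝ) ^ m * ((pp : ℕ) : ℝ) ^ (-((((i : ℕ) + 1 : ℕ) : ℝ) ^ 2 * (P pp (c pp (ev s)) : ℝ)) /
          (e pp (c pp (ev s)) : ℝ)) ≤
        ((pp : ℕ) : ℝ) ^ (-G) * ((pp : ℕ) : ℝ) ^ (∑ a, -((ρin pp (c pp (ev a)) : ℝ) / (e pp (c pp (ev a)) : ℝ))) :=
      hm1.trans (mul_le_mul hΔle hprod_in hprod_nn (by positivity))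
    -- exponents: `m ≤ j²P_s/e_s − G − Σ ρin/e`
    rw [← Real.rpow_intCast, ← Real.rpow_add hp0, ← Real.rpow_add hp0, Real.rpow_le_rpow_left_iff hp1] at hm2
    have hant : (m : ℝ) ≤ ((((i : ℕ) + 1 : ℕ) : ℝ) ^ 2 * (P pp (c pp (ev s)) : ℝ)) / (e pp (c pp (ev s)) : ℝ) - G -
        ∑ a, (ρin pp (c pp (ev a)) : ℝ) / (e pp (c pp (ev a)) : ℝ) := by
      have hsum : ∑ a, -((ρin pp (c pp (ev a)) : ℝ) / (e pp (c pp (ev a)) : ℝ)) =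
          -∑ a, (ρin pp (c pp (ev a)) : ℝ) / (e pp (c pp (ev a)) : ℝ) := by
        rw [Finset.sum_neg_distrib]
      rw [hsum] at hm2
      linarith [hm2, neg_div (e pp (c pp (ev s)) : ℝ) ((((i : ℕ) + 1 : ℕ) : ℝ) ^ 2 * (P pp (c pp (ev s)) : ℝ))]
    -- the composer's cell
    have hcons := hs m (by rw [hG] at hant; exact hant)
    -- back to norms: `p^m·‖t_q(last)‖ ≤ p^{−Σ ρout/e} ≤ ∏‖cout‖`
    rw [hP (Fin.last _), hram (Fin.last _)]
    refine le_trans ?_ hprod_out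
    rw [← Real.rpow_intCast, ← Real.rpow_add hp0, Real.rpow_le_rpow_left_iff hp1]
    have hsum : ∑ a, -((ρout pp (c pp (ev a)) : ℝ) / (e pp (c pp (ev a)) : ℝ)) =
        -∑ a, (ρout pp (c pp (ev a)) : ℝ) / (e pp (c pp (ev a)) : ℝ) := by
      rw [Finset.sum_neg_distrib]
    rw [hsum]
    linarith [hcons, neg_div (e pp (c pp (ev (Fin.last _))) : ℝ) (P pp (c pp (ev (Fin.last _))) : ℝ)]

/-! ## §3. Branch C's antecedent at `settingPrVolSharp`, fibres of several types -/

include ht0 ht htq in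
/-- **BRANCH C's PER-DATUM ANTECEDENT «∃ ρ qK, QPinned ∧ PilotKummerCompatHull» INHABITED AT FIBRES OF SEVERAL TYPES** (any columns
`col`; realising ideles, hypotheses (i)–(iii) of `licence_settingPrVolSharp_of_mixedOrders_of_realises`): the `hSHw`-shaped binder of the
window certificates of record HOLDS at such a datum (abc-iut-w5-d009's `exists_qPinned_and_hull_settingPrVolSharp_iff_licence`; realising
q-ideles have norm `≤ 1`). [cite: Mochizuki2012, IUTchIII Cor. 3.12 Step (xi-d) p. 183, (xi-f) p. 184] [cite: DupuyHilado2025, §3.3, §3.4,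
§3.9, §4.9] [claim: Mochizuki2012, status: disputed] -/
theorem exists_qPinned_and_hull_settingPrVolSharp_of_mixedOrders_of_realises (ty : Nat.Primes → ℕ)
    (c : ∀ pp : Nat.Primes, (thetaIndex X).Fibre (.inr pp) → Fin (ty pp))
    (e D P : ∀ pp : Nat.Primes, Fin (ty pp) → ℕ) (ρin ρout : ∀ pp : Nat.Primes, Fin (ty pp) → ℤ)
    (hloc : ∀ (pp : Nat.Primes) (x : (thetaIndex X).Fibre (.inr pp)),
      haveI : Fact (pp : ℕ).Prime := ⟨pp.2⟩
      placeOf X pp.1 x ∈ X.S →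
        absRamificationIdx (pp : ℕ) (kOf X pp.1 x) = e pp (c pp x) ∧
        (D pp (c pp x) : ℝ) / (e pp (c pp x) : ℝ) ≤ differentOrd (pp : ℕ) (kOf X pp.1 x) ∧
        X.qPilot (placeOf X pp.1 x) = P pp (c pp x) ∧
        (∃ z : kOf X pp.1 x, z ∉ logUnits (kOf X pp.1 x) ∧
          ‖z‖ ≤ ((pp : ℕ) : ℝ) ^ (-(((ρin pp (c pp x) : ℝ) - 1) / (e pp (c pp x) : ℝ)))) ∧
        (∃ z ∈ logUnits (kOf X pp.1 x), ((pp : ℕ) : ℝ) ^ (-((ρout pp (c pp x) : ℝ) / (e pp (c pp x) : ℝ))) ≤ ‖z‖))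
    (hiso : ∀ (pp : Nat.Primes) (x y : (thetaIndex X).Fibre (.inr pp)),
      haveI : Fact (pp : ℕ).Prime := ⟨pp.2⟩
      placeOf X pp.1 x ∈ X.S → placeOf X pp.1 y ∈ X.S → c pp x = c pp y → Nonempty (kOf X pp.1 x ≃ₐ[ℚ_[pp]] kOf X pp.1 y))
    (hcell : ∀ (pp : Nat.Primes) (i : Fin X.lstar) (f : (thetaIndex X).Caps (Setting.labelSucc i) → Fin (ty pp)),
      (haveI : Fact (pp : ℕ).Prime := ⟨pp.2⟩
        ∀ a, ∃ x : (thetaIndex X).Fibre (.inr pp), placeOf X pp.1 x ∈ X.S ∧ c pp x = f a) →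
      ∃ s : (thetaIndex X).Caps (Setting.labelSucc i), ∀ m : ℤ,
        ((m : ℝ) ≤ ((((i : ℕ) + 1 : ℕ) : ℝ) ^ 2 * (P pp (f s) : ℝ)) / (e pp (f s) : ℝ)
            - ((∑ a, (D pp (f a) : ℝ) / (e pp (f a) : ℝ)) - ∑ u ∈ (Finset.univ.image f), (D pp u : ℝ) / (e pp u : ℝ))
            - ∑ a, (ρin pp (f a) : ℝ) / (e pp (f a) : ℝ)) →
        ((m : ℝ) ≤ (P pp (f (Fin.last _)) : ℝ) / (e pp (f (Fin.last _)) : ℝ) - ∑ a, (ρout pp (f a) : ℝ) / (e pp (f a) : ℝ))) :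
    ∃ (ρ : (∀ v : (thetaIndex X).V, v ∈ (thetaIndex X).Vbad → Set ((logShellsDH X logv).StarPacket v)) →
          ∀ (j : (thetaIndex X).Label) (vQ : (thetaIndex X).VQ), Set ((logShellsDH X logv).Packet j vQ))
        (qK : ∀ v : (thetaIndex X).V, v ∈ (thetaIndex X).Vbad → Set ((logShellsDH X logv).StarPacket v)),
        QPinned ({ toSituation := situationPrVol X hlog M archPk archSub Ψ act Mmod region, col := col } :
            LatticeSituation (thetaIndex X))
          (settingPrVolSharp X hlog M archPk archSub Ψ act Mmod region n lat sig split qData tq t htq0 htq1) ρ qK ∧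
        PilotKummerCompatHull ({ toSituation := situationPrVol X hlog M archPk archSub Ψ act Mmod region, col := col } :
            LatticeSituation (thetaIndex X))
          (settingPrVolSharp X hlog M archPk archSub Ψ act Mmod region n lat sig split qData tq t htq0 htq1) ρ qK :=
  (exists_qPinned_and_hull_settingPrVolSharp_iff_licence X hlog M archPk archSub Ψ act Mmod region n lat sig split qData tq t htq0 htq1
    col (fun pp x => norm_qIdele_le_one_of_realises X tq htq0 htq pp x)).2
    (licence_settingPrVolSharp_of_mixedOrders_of_realises X hlog M archPk archSub Ψ act Mmod region n lat sig split qData tq t htq0 htq1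
      ht0 ht htq ty c e D P ρin ρout hloc hiso hcell)

end Summit.ABC.IUTFork.Thm311.Real

end
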